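import Literature.NumberTheory.EllipticCurves.Tian2014.CMPointSystemGenusBridgeThreeModEight
import Literature.NumberTheory.EllipticCurves.Tian2014.CMPointSystemPiPrimeClass
import HarnessLib

/-!
# Monsky 1990 Thm. 5.5, FIRST claim («`S_D ∉ 2Λ_D + T`» for `D = p₃p₅`), transplanted onto Tian's CM points: the ODD
# twist `y_{pq,φ} = Σ_{t∈φ} χ_{pq}(t) z_t ∉ 2E(ℚ(√−pq))⁻ + E[2]` on all of Monsky's case (12) — `N = pq`, `p ≡ 5 (8)`,
# `q ≡ 3 (8)`, either sign of `(p/q)` — from `Printed ∧ GenusTheoryDisplays`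

Cell `bsd-monsky` (prover-A seat, g12). Monsky's Theorem 5.5 (p. 62) has TWO claims: «If `D = p₃p₅` then `S_D ∉ 2Λ_D + T`
and `S_{2D} ∉ 2Λ_{2D} + T`». The cell's enclosure transplanted the SECOND claim (the even twist `N = 2pq`, case (13):
`CMPointSystemMonskyDescent.minusY_of_twoDescentLemma`, the route-A input of Theorem 1.1 on `𝒮⁻`). Monsky's proof of the
first claim is «similar» (p. 62, verbatim: «The proof of the second result is similar»): with the SAME transversal
`φ = G² ∪ JG²`, the SAME point `R = Σ_{G²} P_𝒜`, `S_D + S_{2D} = 2R`, `R^σ − R = (−1, 1)`, `R^τ − R = (−1, −1)`, a halving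
`S_D = 2S + t` (`S ∈ Λ_D`) gives `2(R − S) = S_{2D} + t ∈ Λ_{2D} + T` with the same defects — which Lemma 5.4 (whose
hypothesis (1) reads «`2P ∈ Λ_D` OR `Λ_{2D}`») excludes. This file is that mirror on Tian's points: the odd-twist point
`y_{pq,φ}` (Tian (4.6) with the genus character `χ_{pq}`; Monsky's `S_D` through the licence of p. 51) is the transfer along
`√−pq` of a rational point `y′ ∈ E_{pq}(ℚ)` (Tian Lemma 4.7 / Monsky Thm. 4.7 for the second twist, `exists_transferE_eq_yPointChi`)
with `y′ ∉ 2E_{pq}(ℚ) + E_{pq}(ℚ)_tor`, given the descent lemma at the EVEN twist `N = 2pq` — Monsky Lemma 5.4 on `E` with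
`N = 2pq` (`DescentLemmaPoints.lemma54_point`, stated for every `N ∣ 2pq`; `twoDescentLemma_of_galoisData_three` at `d = 2pq`).
The genus-theory bridge is the one of `monskyDisplays_of_genusTheory` (`(p/q) = −1`) resp. `monskyDisplays_of_genusTheory_plus`
(`(p/q) = +1`, prover-A g10), with the descent lemma instantiated at `2pq` instead of `pq`. Nothing asserted; no named fact.
[cite: Monsky1990MockHeegner, Thm. 5.5 and its proof (p. 62), Lemma 5.4 (p. 62), Thm. 4.7 (pp. 57–58), Thm. 5.14 (12) (p. 66), Cor. 5.15 (2) (p. 66)]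
[cite: Tian2014, §4.2 (4.6) (p0022 L84–L96), Lemma 4.7 (J151–152), Thm. 2.8 (p0011 L37–L44), Notations (i)–(iii) (J122–123)]
-/

noncomputable section

open scoped Classical NumberTheorySymbols

open WeierstrassCurve NumberField Literature.NumberTheory.EllipticCurves
  Literature.NumberTheory.EllipticCurves.TianYuanZhang2017 Literature.GroupTheory.FiniteAbelian

namespace Literature.NumberTheory.EllipticCurves.Tian2014

namespace CMPointData

open Literature.NumberTheory.EllipticCurves.Monsky1990

variable {n : ℕ}

/-! ## §1 Monsky Thm. 5.5, first claim, transplanted: the odd-twist point is not halvable modulo `E[2]` -/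

section FiveFiveOdd

variable (D : CMPointData n) {θ' : D.H}

/-- **Monsky Thm. 5.5, FIRST claim, transplanted onto Tian's points: `y_{n,φ} ∉ 2E(ℚ(√−n))⁻ + E[2]`** — the odd-twist
point `y_{n,φ} = Σ_{t∈φ} χ_n(t) z_t` (`φ = G² ∪ JG²`) is the transfer along `θ′ = √−n` of a rational point `y₁` of `E_n`
which is NOT of the form `2z + t`. Mirror of `minusY_of_twoDescentLemma` (the second claim): with `R = Σ_{G²} z_t`,
`y_{n,φ} + y_{2n,φ} = 2R`, `R^σ − R = ε`, `R^τ − R = (0,0)` (`|G²|` odd); if `y_{n,φ} = 2S + t` then `P := R − S` has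
`2P = y_{2n,φ} + t` rational over `K = ℚ(√−2n)` (Thm. 4.7 for the even twist, `exists_transfer_eq_yPoint`), `P^σ − P = ε`,
`P^τ − P = (0,0)` (`σ_m`, `σ_{1+ϖ}` fix `√−n`) — excluded by the descent lemma `h5x` at the EVEN twist (Monsky Lemma 5.4:
«`2P ∈ Λ_D` or `Λ_{2D}`»). Inputs beyond `Printed`: the genus facts `hGD`, `hπsq`, `hodd`, `hJ`, the second-twist
data for `√−n`, an ambiguous class `B ∉ {1, m}`, and `h5x` (Lemma 5.4 at `N = 2n`).
[cite: Monsky1990MockHeegner, Thm. 5.5 and its proof (p. 62: «The proof of the second result is similar»), Lemma 5.4 (p. 62), Thm. 4.7 (pp. 57–58)]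
[cite: Tian2014, (4.6) (p0022 L84–L96), Lemma 4.7 (J151–152)] -/
theorem minusYChi_of_twoDescentLemma (hn : n ≠ 0) (hsqn : Squarefree n) (hP : D.Printed)
    (hθ'n : θ' ^ 2 = algebraMap ℚ D.H (-(n : ℚ))) (hθ'0 : θ' ≠ 0)
    (hπθ' : D.art D.piPrime θ' = θ') (hτθ' : D.tau θ' = θ') (hcθ' : D.conj θ' = -θ')
    {B : ClassGroup (𝓞 (GenusField (2 * n)))} (hB2 : B * B = 1) (hB1 : B ≠ 1) (hBπ : B ≠ D.piPrime)
    (hGD : ∀ t : ClassGroup (𝓞 (GenusField (2 * n))), D.chi θ' t = 1 ↔ (IsSquare t ∨ IsSquare (D.piPrime * t)))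
    (hπsq : ¬ IsSquare D.piPrime)
    (hodd : Odd (Finset.univ.filter (IsSquare : ClassGroup (𝓞 (GenusField (2 * n))) → Prop)).card)
    {J : ClassGroup (𝓞 (GenusField (2 * n)))} (hJ : D.chi θ' J = -1)
    (h5x : ∀ P : EPoint D.H, (∃ y', D.transfer hn y' = (2 : ℕ) • P) →
      D.act (D.art D.piPrime) P - P = (if n % 8 = 7 then ptOne else ptNegOne) →
      D.act D.tau P - P = ptZero → False) :
    ∃ φ, D.IsRepsModPiPrime φ ∧ ∃ y₁ : (congruentNumberCurve n).toAffine.Point,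
      transferE n θ' hθ'n hθ'0 y₁ = D.yPointChi θ' φ ∧
      ∀ z t : (congruentNumberCurve n).toAffine.Point, IsOfFinAddOrder t → y₁ ≠ (2 : ℤ) • z + t := by
  classical
  have hP' := hP
  obtain ⟨h1, -, h3, h48, -, -, -, -, -, -, -⟩ := hP'
  set sq := Finset.univ.filter (IsSquare : ClassGroup (𝓞 (GenusField (2 * n))) → Prop) with hsq
  set φ := sq ∪ sq.image (fun t => J * t) with hφdef
  have hφ : D.IsRepsModPiPrime φ := D.isRepsModPiPrime_sq_union hθ'n hπθ' hGD hπsq hJ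
  obtain ⟨y₁, hy₁⟩ := D.exists_transferE_eq_yPointChi hθ'0 hP n hn hθ'n hπθ' hτθ' hcθ' hB2 hB1 hBπ hφ
  refine ⟨φ, hφ, y₁, hy₁, ?_⟩
  intro z t ht heq
  have ht2 : (2 : ℕ) • t = 0 := two_nsmul_eq_zero_of_isOfFinAddOrder_congruentNumberCurve hsqn ht
  -- `R := Σ_{G²} z_u`
  set R : EPoint D.H := ∑ u ∈ sq, D.z u with hR
  have hdisj : Disjoint sq (sq.image (fun t => J * t)) := by
    rw [Finset.disjoint_left]
    intro u hu hu'
    rw [Finset.mem_image] at hu'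
    obtain ⟨v, hv, rfl⟩ := hu'
    rw [hsq, Finset.mem_filter] at hu hv
    have := D.chi_of_isSquare hθ'n (hu.2.mul hv.2.inv)
    rw [mul_inv_cancel_right, hJ] at this
    norm_num at this
  have hinjJ : Set.InjOn (fun t => J * t) ↑sq := fun a _ b _ hab => mul_left_cancel hab
  have hsum1 : D.yPoint φ = R + ∑ u ∈ sq, D.z (J * u) := by
    rw [yPoint, hφdef, Finset.sum_union hdisj, Finset.sum_image hinjJ]
  have hsum2 : D.yPointChi θ' φ = R - ∑ u ∈ sq, D.z (J * u) := by
    rw [yPointChi, hφdef, Finset.sum_union hdisj, Finset.sum_image hinjJ, sub_eq_add_neg,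
      ← Finset.sum_neg_distrib]
    congr 1
    · exact Finset.sum_congr rfl (fun u hu => by
        rw [D.chi_of_isSquare hθ'n ((Finset.mem_filter.mp hu).2), one_zsmul])
    · exact Finset.sum_congr rfl (fun u hu => by
        rw [D.chi_mul hθ'n, hJ, D.chi_of_isSquare hθ'n ((Finset.mem_filter.mp hu).2), mul_one, neg_one_zsmul])
  have h2R : D.yPointChi θ' φ + D.yPoint φ = (2 : ℕ) • R := by
    rw [hsum1, hsum2, two_nsmul]; abel
  -- `R^σ − R = ε`, `R^τ − R = (0,0)` (`|G²|` odd)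
  set ε : EPoint D.H := if n % 8 = 7 then ptOne else ptNegOne with hε
  have hε2 : (2 : ℕ) • ε = 0 := by
    rw [hε]; split_ifs
    · exact two_nsmul_ptOne
    · exact two_nsmul_ptNegOne
  have hsh : ∀ u, D.z (D.piPrime * u) = D.z u + ε := by
    intro u
    have := h3 u
    rw [sub_eq_iff_eq_add] at this
    rw [this, hε, add_comm]
  have hRσ : D.act (D.art D.piPrime) R - R = ε := by
    have : D.act (D.art D.piPrime) R = R + ∑ _u ∈ sq, ε := by
      rw [hR, map_sum, ← Finset.sum_add_distrib]
      exact Finset.sum_congr rfl (fun u _ => by rw [h48, hsh u])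
    rw [this, Finset.sum_const, odd_nsmul_of_two_nsmul_eq_zero hε2 hodd, add_sub_cancel_left]
  have hRτ : D.act D.tau R - R = ptZero := by
    have : D.act D.tau R = R + ∑ _u ∈ sq, (ptZero : EPoint D.H) := by
      rw [hR, map_sum, ← Finset.sum_add_distrib]
      exact Finset.sum_congr rfl (fun u _ => h1 u)
    rw [this, Finset.sum_const, odd_nsmul_of_two_nsmul_eq_zero two_nsmul_ptZero hodd, add_sub_cancel_left]
  -- the even-twist point `y_{2n,φ}` is rational over `K` (Thm. 4.7)
  obtain ⟨y₂, hy₂⟩ := D.exists_transfer_eq_yPoint hn hP hB2 hB1 hBπ hφ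
  -- the hypothetical halving `y_{n,φ} = 2S + T` inside `E(ℚ(√−n))⁻`
  set S : EPoint D.H := transferE n θ' hθ'n hθ'0 z with hS
  set T : EPoint D.H := transferE n θ' hθ'n hθ'0 t with hT
  have hyST : D.yPointChi θ' φ = (2 : ℕ) • S + T := by
    rw [← hy₁, heq, map_add, map_zsmul, two_zsmul, two_nsmul]
  have hT2 : (2 : ℕ) • T = 0 := by rw [hT, ← map_nsmul, ht2, map_zero]
  set P : EPoint D.H := R - S with hPdef
  -- `2P = y_{2n,φ} + T` is in the transfer image of `E_{2n}(ℚ)`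
  have htr : D.transfer hn = transferE (2 * n) D.sqrtNegTwoN D.sqrtNegTwoN_sq' (D.sqrtNegTwoN_ne_zero hn) := rfl
  have h2n : 2 * n ≠ 0 := by omega
  have hTimg : ∃ t', D.transfer hn t' = T := by
    rcases eq_zero_or_pt_of_two_nsmul_eq_zero T hT2 with h0 | h0 | h0 | h0
    · exact ⟨0, by rw [map_zero, h0]⟩
    · exact ⟨_, by rw [htr, transferE_some_zero_zero (2 * n) h2n, h0]⟩
    · exact ⟨_, by rw [htr, transferE_twoTorsionNegN (2 * n) h2n, h0]⟩
    · exact ⟨_, by rw [htr, transferE_twoTorsionPosN (2 * n) h2n, h0]⟩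
  obtain ⟨t', ht'⟩ := hTimg
  have h2P : (2 : ℕ) • P = D.transfer hn (y₂ + t') := by
    rw [map_add, hy₂, ht', hPdef, smul_sub, ← h2R, hyST]; abel
  -- `P^σ − P = ε`, `P^τ − P = (0,0)`: `S` is fixed by `σ_m` and `σ_{1+ϖ}` (both fix `√−n`)
  have hSσ : D.act (D.art D.piPrime) S = S := by
    rw [hS]; exact act_transferE_of_fix n _ _ _ _ hπθ' z
  have hSτ : D.act D.tau S = S := by
    rw [hS]; exact act_transferE_of_fix n _ _ _ _ hτθ' z
  have hPσ : D.act (D.art D.piPrime) P - P = ε := by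
    rw [hPdef, map_sub, hSσ, ← hRσ]; abel
  have hPτ : D.act D.tau P - P = ptZero := by
    rw [hPdef, map_sub, hSτ, ← hRτ]; abel
  exact h5x P ⟨y₂ + t', h2P.symm⟩ hPσ hPτ

end FiveFiveOdd

/-! ## §2 The bridge from Tian's genus theory as printed, on ALL of Monsky's case (12)/(13) (`q ≡ 3 (8)`, either sign) -/

/-- **Monsky Thm. 5.5, first claim, on ALL of `{p ≡ 5 (8), q ≡ 3 (8)}` from `Printed ∧ GenusTheoryDisplays`**: there are
`θ′ = √p·√−q` (`θ′² = −pq`), a transversal `φ` of `𝒜/[ϖ′]` and a rational point `y₁ ∈ E_{pq}(ℚ)` with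
`transfer_{√−pq} y₁ = y_{pq,φ}` and `y₁ ∉ 2E_{pq}(ℚ) + E_{pq}(ℚ)_tor` — the genus-theory bridge of
`monskyDisplays_of_genusTheory` (`(p/q) = −1`) resp. `monskyDisplays_of_genusTheory_plus` (`(p/q) = +1`), with Monsky's
Lemma 5.4 instantiated at the even twist `N = 2pq` (`twoDescentLemma_of_galoisData_three`, `d = 2pq`, `θ = √−2pq`).
[cite: Monsky1990MockHeegner, Thm. 5.5 and Lemma 5.4 (p. 62), Thm. 5.14 (12) (p. 66)]
[cite: Tian2014, Notations (i)–(iii) (J122–123), Lemma 4.7 (J151–152), (4.6) (p0022 L84–L96)] -/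
theorem exists_minusYChi_of_genusTheoryDisplays_three_mod_eight {p q : ℕ} (D : CMPointData (p * q)) (hP : D.Printed)
    (hp : p.Prime) (hq : q.Prime) (hp8 : p % 8 = 5) (hq8 : q % 8 = 3) (hG : D.GenusTheoryDisplays) :
    ∃ (θ' : D.H) (hθ' : θ' ^ 2 = algebraMap ℚ D.H (-((p * q : ℕ) : ℚ))) (hθ'0 : θ' ≠ 0)
      (φ : Finset (ClassGroup (𝓞 (GenusField (2 * (p * q)))))), D.IsRepsModPiPrime φ ∧
      ∃ y₁ : (congruentNumberCurve (p * q)).toAffine.Point,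
        transferE (p * q) θ' hθ' hθ'0 y₁ = D.yPointChi θ' φ ∧
        ∀ z t : (congruentNumberCurve (p * q)).toAffine.Point, IsOfFinAddOrder t → y₁ ≠ (2 : ℤ) • z + t := by
  have hq4 : q % 4 = 3 := by omega
  have hne : p ≠ q := fun h => by omega
  have hn : p * q ≠ 0 := Nat.mul_ne_zero hp.ne_zero hq.ne_zero
  have hsqn : Squarefree (p * q) :=
    Nat.squarefree_mul_iff.mpr ⟨(Nat.coprime_primes hp hq).mpr hne, hp.prime.squarefree, hq.prime.squarefree⟩
  have hn7 : (p * q) % 8 = 7 := by rw [Nat.mul_mod, hp8, hq8]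
  have hP' := hP
  obtain ⟨-, -, -, -, hart, ⟨htaui, htauN, -⟩, -, -, -, -, -⟩ := hP'
  obtain ⟨sqrtP, sqrtNegQ, cp, cq, hPs, hQs, hm, hcp2, hcq2, h2tor, hsq, r1, r2, r3, r4, hτP, hτQ, hcP, hcQ⟩ := hG
  obtain ⟨hsP, hsQ⟩ := sqrt_ne_zero_of_prime hp hq hPs hQs
  have hN : D.sqrtNegTwoN ^ 2 = -(2 * p * q) := by
    rw [D.sqrtNegTwoN_sq]; push_cast; ring
  have hd : 2 * (p * q) ∣ 2 * p * q := ⟨1, by ring⟩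
  have h2n : 2 * (p * q) ≠ 0 := by omega
  have hg : (p : ℤ).gcd q = 1 := by
    rw [Int.gcd_natCast_natCast]; exact (Nat.coprime_primes hp hq).mpr hne
  rcases jacobiSym.eq_one_or_neg_one hg with hpq | hpq
  · -- `(p/q) = +1`: the roles of `[𝔭_p]`, `[𝔭_q]` exchanged (prover-A g10)
    obtain ⟨h2sq, hqsq, hσ2, hσP, hσQ, hτ2, -, hτq⟩ :=
      galoisData_of_genusRule_plus D.art D.tau hp hq hp8 hq8 hpq hm D.im_sq hPs hQs hN r1 r2 r3 r4
        (fun s => (hart s).1) (fun s => (hart s).2) htaui hτP hτQ htauN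
    obtain ⟨hcpP, hcpQ, hcqP, hcqQ⟩ :=
      ramifiedClassActions_of_genusRule_plus D.art hp8 hq8 hpq hPs hQs r1 r2 r3 r4
    have hm' : D.piPrime = cq * cp := hm.trans (mul_comm cp cq)
    have h2tor' : ∀ t : ClassGroup (𝓞 (GenusField (2 * (p * q)))), t * t = 1 →
        t = 1 ∨ t = D.piPrime ∨ t = cq ∨ t = cp := by
      intro t ht
      rcases h2tor t ht with h | h | h | h
      · exact Or.inl h
      · exact Or.inr (Or.inl h)
      · exact Or.inr (Or.inr (Or.inr h))
      · exact Or.inr (Or.inr (Or.inl h))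
    have hcpQ' : D.art cp sqrtNegQ = if q % 8 = 3 then sqrtNegQ else -sqrtNegQ := by
      rw [if_pos hq8]; exact hcpQ
    obtain ⟨hmsq, hodd, ⟨-, hcq1, hcqm⟩, h3case, -⟩ :=
      classGroupFacts_of_genusTheory D.art hPs hQs hsP hsQ hm' hcq2 hcp2 h2tor' hsq hcqP hcqQ hcpP hcpQ'
    have hsec := secondTwist_of_galoisData (D.art D.piPrime) D.tau D.conj hq4 D.im_sq hPs hQs
      (hart D.piPrime).1 hσP (by rw [if_pos hq8]; exact hσQ) hτP hτQ hcP hcQ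
    obtain ⟨hθ2, hσθ, hτθ, hcθ⟩ := hsec.1 hq8
    obtain ⟨hGD, hJ⟩ := h3case hq8
    have hθ2' : (sqrtP * sqrtNegQ) ^ 2 = algebraMap ℚ D.H (-((p * q : ℕ) : ℚ)) := by
      rw [hθ2, map_neg, map_natCast]
    have hθ0 : sqrtP * sqrtNegQ ≠ 0 := mul_ne_zero hsP hsQ
    have h5x := D.twoDescentLemma_of_galoisData_three hP hp hq hp8 hq8 h2sq hPs hqsq hσ2 hσP hσQ hτ2 hτP hτq
      hd h2n D.sqrtNegTwoN_sq' (D.sqrtNegTwoN_ne_zero hn)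
    refine ⟨sqrtP * sqrtNegQ, hθ2', hθ0, ?_⟩
    refine D.minusYChi_of_twoDescentLemma hn hsqn hP hθ2' hθ0 hσθ hτθ hcθ hcq2 hcq1 hcqm ?_ hmsq hodd
      (J := cq) ?_ ?_
    · intro t
      rw [D.chi_eq_one_iff, hGD t]
    · unfold chi
      rw [if_neg hJ]
    · intro P hA hσA hτA
      rw [if_pos hn7] at hσA
      exact h5x P hA hσA hτA
  · -- `(p/q) = −1`: the `𝒮⁻` bridge of `monskyDisplays_of_genusTheory`
    obtain ⟨h2sq, hqsq, hσ2, hσP, hσQ, hτ2, -, hτq⟩ :=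
      galoisData_of_genusRule D.art D.tau hp hq hp8 hq4 hpq hm D.im_sq hPs hQs hN r1 r2 r3 r4
        (fun s => (hart s).1) (fun s => (hart s).2) htaui hτP hτQ htauN
    obtain ⟨hcpP, hcpQ, hcqP, hcqQ⟩ := ramifiedClassActions_of_genusRule D.art hp8 hq4 hpq hPs hQs r1 r2 r3 r4
    obtain ⟨hmsq, hodd, ⟨-, hcp1, hcpm⟩, h3case, -⟩ :=
      classGroupFacts_of_genusTheory D.art hPs hQs hsP hsQ hm hcp2 hcq2 h2tor hsq hcpP hcpQ hcqP hcqQ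
    have hsec := secondTwist_of_galoisData (D.art D.piPrime) D.tau D.conj hq4 D.im_sq hPs hQs
      (hart D.piPrime).1 hσP hσQ hτP hτQ hcP hcQ
    obtain ⟨hθ2, hσθ, hτθ, hcθ⟩ := hsec.1 hq8
    obtain ⟨hGD, hJ⟩ := h3case hq8
    have hθ2' : (sqrtP * sqrtNegQ) ^ 2 = algebraMap ℚ D.H (-((p * q : ℕ) : ℚ)) := by
      rw [hθ2, map_neg, map_natCast]
    have hθ0 : sqrtP * sqrtNegQ ≠ 0 := mul_ne_zero hsP hsQ
    simp only [hq8, if_true] at hσ2 hσQ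
    have h5x := D.twoDescentLemma_of_galoisData_three hP hp hq hp8 hq8 h2sq hPs hqsq hσ2 hσP hσQ hτ2 hτP hτq
      hd h2n D.sqrtNegTwoN_sq' (D.sqrtNegTwoN_ne_zero hn)
    refine ⟨sqrtP * sqrtNegQ, hθ2', hθ0, ?_⟩
    refine D.minusYChi_of_twoDescentLemma hn hsqn hP hθ2' hθ0 hσθ hτθ hcθ hcp2 hcp1 hcpm ?_ hmsq hodd
      (J := cp) ?_ ?_
    · intro t
      rw [D.chi_eq_one_iff, hGD t]
    · unfold chi
      rw [if_neg hJ]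
    · intro P hA hσA hτA
      rw [if_pos hn7] at hσA
      exact h5x P hA hσA hτA

/-- **The same from the CORE displays** (`PrintedCore ∧ GenusTheoryDisplaysCore`, the typer g12's reduced display, on all of
`{p ≡ 5 (8), q ≡ 3 (8)}`): the full displays are recovered on either sign (`genusTheoryDisplays_of_genusTheoryDisplaysCore`
on `(p/q) = −1`; on `(p/q) = +1` the struck conjunct «`[ϖ′] = [𝔭_p][𝔭_q]`» is `piPrime_eq_mul_of_genusRule_plus`-type —
here re-derived inline from `ramifiedClassActions_of_genusRule_plus`). [cite: Tian2014, Notations (i)–(iii) (J122–123)]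
[cite: Monsky1990MockHeegner, Thm. 5.5 (p. 62)] -/
theorem exists_minusYChi_of_core_three_mod_eight {p q : ℕ} (D : CMPointData (p * q)) (hP : D.PrintedCore)
    (hp : p.Prime) (hq : q.Prime) (hp8 : p % 8 = 5) (hq8 : q % 8 = 3) (hG : D.GenusTheoryDisplaysCore) :
    ∃ (θ' : D.H) (hθ' : θ' ^ 2 = algebraMap ℚ D.H (-((p * q : ℕ) : ℚ))) (hθ'0 : θ' ≠ 0)
      (φ : Finset (ClassGroup (𝓞 (GenusField (2 * (p * q)))))), D.IsRepsModPiPrime φ ∧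
      ∃ y₁ : (congruentNumberCurve (p * q)).toAffine.Point,
        transferE (p * q) θ' hθ' hθ'0 y₁ = D.yPointChi θ' φ ∧
        ∀ z t : (congruentNumberCurve (p * q)).toAffine.Point, IsOfFinAddOrder t → y₁ ≠ (2 : ℤ) • z + t := by
  have hne : p ≠ q := fun h => by omega
  have hg : (p : ℤ).gcd q = 1 := by
    rw [Int.gcd_natCast_natCast]; exact (Nat.coprime_primes hp hq).mpr hne
  have hG' : D.GenusTheoryDisplays := by
    rcases jacobiSym.eq_one_or_neg_one hg with hj | hj
    · obtain ⟨sqrtP, sqrtNegQ, cp, cq, hPs, hQs, hcp2, hcq2, h2tor, hsq, r1, r2, r3, r4, hτP, hτQ, hcP, hcQ⟩ := hG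
      obtain ⟨hsP, hsQ⟩ := sqrt_ne_zero_of_prime hp hq hPs hQs
      obtain ⟨hcpP, hcpQ, -, hcqQ⟩ :=
        ramifiedClassActions_of_genusRule_plus D.art hp8 hq8 hj hPs hQs r1 r2 r3 r4
      have hcp1 : cp ≠ 1 := by
        intro h
        rw [h, map_one, AlgEquiv.one_apply] at hcpP
        exact hsP (CharZero.eq_neg_self_iff.mp hcpP)
      have hcq1 : cq ≠ 1 := by
        intro h
        rw [h, map_one, AlgEquiv.one_apply] at hcqQ
        exact hsQ (CharZero.eq_neg_self_iff.mp hcqQ)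
      have hcpcq : cp ≠ cq := by
        intro h
        rw [h, hcqQ] at hcpQ
        exact hsQ (CharZero.neg_eq_self_iff.mp hcpQ)
      have h2 : (cp * cq) * (cp * cq) = 1 := by
        rw [mul_mul_mul_comm, hcp2, hcq2, one_mul]
      have hm : D.piPrime = cp * cq := by
        rcases h2tor _ h2 with h | h | h | h
        · exfalso
          apply hcpcq
          calc cp = cp * (cq * cq) := by rw [hcq2, mul_one]
            _ = (cp * cq) * cq := by rw [mul_assoc]
            _ = cq := by rw [h, one_mul]
        · exact h.symm
        · exact absurd (mul_left_cancel (h.trans (mul_one cp).symm)) hcq1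
        · exact absurd (mul_right_cancel (h.trans (one_mul cq).symm)) hcp1
      exact ⟨sqrtP, sqrtNegQ, cp, cq, hPs, hQs, hm, hcp2, hcq2, h2tor, hsq, r1, r2, r3, r4, hτP, hτQ, hcP, hcQ⟩
    · exact D.genusTheoryDisplays_of_genusTheoryDisplaysCore hp hq hp8 (by omega) hj hG
  have hP' : D.Printed := D.printed_of_printedReduced
    (D.printedReduced_of_printedCore hP (D.piPrime_mul_piPrime_of_genusTheoryDisplays hG'))
  exact D.exists_minusYChi_of_genusTheoryDisplays_three_mod_eight hP' hp hq hp8 hq8 hG'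

end CMPointData

end Literature.NumberTheory.EllipticCurves.Tian2014

end
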